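import Summits.HodgeConjecture.HodgeConjecture.Theorems.F0P2iGRDLocality   -- ★ GRD-LOC file 1∕2 (F0P2-p02 (g4)): §1–§4, `thetaTypeAt_congr_of_semilocal_eq`
import HarnessLib

/-!
# FLOOR-0 P2 — PKΠ RUNG 4, row «GRD-LOC» (file 2∕2): the dictionary matrix `GRDMatrix` and the letter `StubGRD` are LOCAL in `μ`

Cell hodgecm-mathlib (D-0151), FLOOR 0, programme P2 (theta ∕ `hdictE`); crux item H413 = stmt-HodgeConjecture-24833 (`HCCMUnconditional.H413`).
Sub-line of record `Cruxes/H413/Lines/F0_P2PKPiRung4.lean` v1.1 (F0P2-plan (g6); sha16 2e54cdb2dda5824f).  Seat F0P2-p02 (g4), row «GRD-LOC» (P2 bus GO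
08:45:14Z (1); shapes confirmed 08:56:55Z).  Sequel of ★ `Theorems/F0P2iGRDLocality.lean` (§1–§4: the theta representation `X_v(μ,ε,χf)∘κ_v⁻¹`, hence
`IsoAtXf` and `ThetaTypeAt`, depend on `μ` only through `(toHeckeCharacter L μ).semilocalComponent L v` [Kudla1994 Thm. 3.1; Liu2021 App. D §D.1 Step 2]).
THEOREMS ONLY (no `def`, no instance, no notation, no named fact, no `sorry`); never imports a `Cruxes/…/Lines` module (O50-1 ∕ s347 ∕ s380b);
`--supports stmt-HodgeConjecture-24833 --as helper`.  HC_CM is proved only modulo the printed citations until rung 0 closes; this file discharges none of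
them.

* §5 `grdMatrix_of_semilocal_eq` — hypothesis∕conclusion = the body of the sub-line's `GRDMatrix` (v1.1 :285) VERBATIM at `(μ', hμ')` resp. `(μ, hμ)`,
  with `ThetaTypeAt` (v1.1 :247) INLINED at its two slots — in the (N)-slot the inner binder `T : Type` of `ThetaTypeAt` is α-renamed `T'` (it would
  otherwise be captured by the form-congruence binder `T : GL₃` of the (N) clause); α-renaming is invisible to the kernel, so `GRDMatrix … μ hμ χf` unfolds
  to the conclusion definitionally.  Proof: §4 slot by slot.
* §6 `stubGRD_of_pointwise` — «`StubGRD` ⟸ the matrix AT THE DICTIONARY PAIR»: conclusion = the body of `StubGRD` (v1.1 :318: `Continuous χf ∧ (∀ z,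
  ‖χf z‖ = 1) ∧ ∀ μ hμ, locality → GRDMatrix …`) VERBATIM (same inlining); hypothesis = the same binders with the `∀ μ` locality clause replaced by the
  matrix at `(μ₀, hμ₀)`.  Under the DICT-CHOICE PROTOCOL (P2 bus 08:32:01Z: named pair `grdMu`∕`grdChi` in `Theorems/F0P2iGRDWitness.lean`, p01 (g5))
  the assembly of the registered stub is ONE application:
  `stubGRD_holds := stubGRD_of_pointwise (fun L _ _ _ H hH hHd _ e₁ dV hdV hdV0 g hg ξ μω hμu hquad =>
     ⟨grdMu …, isConjugateSymplectic_grdMu …, grdChi …, continuous_grdChi …, norm_grdChi …, ‹(S)-closer at grdMu›, ‹(N)-closer at grdMu›⟩)`.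

## References
* [GelbartRogawski1991] S. Gelbart, J. Rogawski, Invent. Math. 105 (1991): §5.1 (5.1.1), Lem. 5.1.2 p. 466 (the dictionary `ξ ↦ (μ_ξ, χ_ξ)`).
* [Rogawski1990] J. Rogawski, Ann. of Math. Stud. 123 (1990): Lemma 4.13.1 (b) p. 62; §12.2 (2) p. 174; §13.3 p. 195 (`φ = μ η̃`).
* [Kudla1994] S. Kudla, Israel J. Math. 87 (1994): §3 Thm. 3.1.  [Liu2021] Y. Liu, arXiv:2102.11518: Def. 4.11, App. D §D.1 Step 2.
-/

set_option autoImplicit false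
-- the mandated namespace has the single-problem summit's repeated segment (`HodgeConjecture.HodgeConjecture`)
set_option linter.dupNamespace false

noncomputable section

open NumberField MeasureTheory IsDedekindDomain
open scoped Matrix ComplexOrder

namespace Summit.HodgeConjecture.HodgeConjecture.Cruxes.H413.F0P2iGRDMatrixLocality

open Literature.NumberTheory Literature.NumberTheory.Automorphic Literature.NumberTheory.Automorphic.UnitaryGroup
open Literature.NumberTheory.Automorphic.UnitaryGroup.CotangentForms
open Literature.NumberTheory.Automorphic.IdeleClassGroup
open Literature.NumberTheory.Automorphic.Liu2021 Literature.NumberTheory.Automorphic.Liu2021.Def411WeilCarriers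
open Literature.NumberTheory.Automorphic.Liu2021.Def411WeilCarriersDoubling
open Literature.NumberTheory.GelbartRogawski1991 Literature.NumberTheory.GelbartRogawski1991.UnitaryDualPair
open Literature.NumberTheory.GelbartRogawski1991.UnitaryDualPair.WeilCoinv
open Literature.RepresentationTheory Literature.RepresentationTheory.Liu2021
open Literature.NumberTheory.GaloisRepresentations
open Literature.NumberTheory.Rogawski1990
open Summit.HodgeConjecture.CorCM.Transposition

/-! ## §5 The dictionary matrix `GRDMatrix` (v1.1 :285, `ThetaTypeAt` inlined) is local in `μ` -/

set_option synthInstance.maxHeartbeats 400000 in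
set_option maxHeartbeats 8000000 in
/-- **`GRDMatrix` is local in `μ`**: if `μ` and `μ'` (conjugate-symplectic) have the same semi-local components at every finite place, the finite
Gelbart–Rogawski dictionary matrix for `(μ', χf)` implies the matrix for `(μ, χf)`.  Hypothesis and conclusion = the body of `F0P2PKPiRung4.GRDMatrix`
(v1.1 :285) VERBATIM at `(μ', hμ')` resp. `(μ, hμ)`, with the sub-line's `ThetaTypeAt` (v1.1 :247) INLINED at its two slots (the (N)-slot's inner binder
`T : Type` α-renamed `T'`, so that it is not captured by the form-congruence binder `T : GL₃` — definitionally the same term); proof = §4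
`thetaTypeAt_congr_of_semilocal_eq` slot by slot. [cite: GelbartRogawski1991, §5.1 (5.1.1), Lem 5.1.2 p. 466] [cite: Rogawski1990, Lemma 4.13.1 (b) p. 62; §12.2 (2) p. 174]
[cite: Kudla1994, §3 Thm. 3.1] -/
theorem grdMatrix_of_semilocal_eq (L : Type) [Field L] [NumberField L] [IsCMField L] (H : Matrix (Fin 3) (Fin 3) L) (hH : (H.map (cmConjRingHom L))ᵀ = H) (hHd : IsUnit H.det)
    {n' : ℕ} (e₁ : Fin 3 × Fin 1 ≃ Fin n') (dV : Fin 3 → L) (hdV : ∀ i, IsCMField.complexConj L (dV i) = dV i) (hdV0 : ∀ i, dV i ≠ 0) (g : GL (Fin 3) L)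
    (hg : ((g : Matrix (Fin 3) (Fin 3) L).map (cmConjRingHom L))ᵀ * H * (g : Matrix (Fin 3) (Fin 3) L) = Matrix.diagonal dV)
    (ξ : OneDimAutRepH L) (μω : HeckeCharacter L) (hμu : μω.IsUnitary)
    (μ μ' : Literature.NumberTheory.Automorphic.IdeleClassGroup L →ₜ* Circle) (hμ : IsConjugateSymplectic L μ)
    (hμ' : IsConjugateSymplectic L μ')
    (χf : UnitaryGroup.finAdelicOne (↥(maximalRealSubfield L)) L (IsCMField.complexConj L) →* ℂˣ)
    (hsl : ∀ v : HeightOneSpectrum (𝓞 ↥(maximalRealSubfield L)),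
      (toHeckeCharacter L μ).semilocalComponent L v = (toHeckeCharacter L μ').semilocalComponent L v)
    (hm :
      (∀ Pv : ∀ v : HeightOneSpectrum (𝓞 ↥(maximalRealSubfield L)), CMLocalAPacket L H v,
          ξ.IsXiLocalFamily hH hHd μω hμu Pv →
          ∀ (v : HeightOneSpectrum (𝓞 ↥(maximalRealSubfield L))),
            (∃ w : PlacesOver L v, IsCMField.complexConj L • w.1 ≠ w.1) →
            ∀ c : IrrClass ((cmDatum L 3 H).Local v), c ∈ (Pv v).members →
              ∃ ε : (↥(maximalRealSubfield L))ˣ,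
                (∀ (T : Type) [AddCommGroup T] [Module ℂ T] (τ : Representation ℂ ↥(localPi L (IsCMField.complexConj L) 3 H v) T), τ.IsIrreducible →
                  (IrrClass.comap (localPiEquiv L (IsCMField.complexConj L) 3 H v) c).IsConstituentOf τ →
                  ∀ (W' : Type) [AddCommGroup W'] [Module ℂ W'] (ρ' : Representation ℂ ↥(localPi L (IsCMField.complexConj L) 3 H v) W'),
                    isotypicComponent (MonoidAlgebra ℂ (localPi L (IsCMField.complexConj L) 3 H v)) (Representation.asModule ρ')
                        (Representation.asModule τ) = ⊤ →
                    isotypicComponent (MonoidAlgebra ℂ (localPi L (IsCMField.complexConj L) 3 H v)) (Representation.asModule ρ')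
                      (Representation.asModule
                        (((show Representation ℂ (localPi L (IsCMField.complexConj L) 3 (Matrix.diagonal dV) v) _ from
                          (TwistedCoinv.rep (localCharOfCenter (↥(maximalRealSubfield L)) L (IsCMField.complexConj L)
                              (JW (↥(maximalRealSubfield L)) L ε) (JW_apply_ne_zero (↥(maximalRealSubfield L)) L ε) χf v)
                            ((OmegaChiSplitting.chiLocalSplittingsD ⟨L⟩ e₁ dV hdV hdV0 (toHeckeCharacter L μ')
                              ((isOscillatorChar_toHeckeCharacter_iff μ').mpr hμ') ε).omegaLoc v)
                            (commute_omegaLoc_localCenter (↥(maximalRealSubfield L)) L (IsCMField.complexConj L) 3 e₁ (Matrix.diagonal dV)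
                              (JW (↥(maximalRealSubfield L)) L ε) (complexConj_imagUnit L) (imagUnit_ne_zero L) (imagUnit_mul_self L)
                              (realDiagonal_isSymm L dV hdV) (isSymm_TW (↥(maximalRealSubfield L)) ε) (realDiagonal_map L dV hdV).symm
                              (JW_eq (↥(maximalRealSubfield L)) L ε) (JW_apply_ne_zero (↥(maximalRealSubfield L)) L ε)
                              (OmegaChiSplitting.chiLocalSplittingsD ⟨L⟩ e₁ dV hdV hdV0 (toHeckeCharacter L μ')
                                ((isOscillatorChar_toHeckeCharacter_iff μ').mpr hμ') ε) v)).comp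
                            (UnitaryGroup.localLineInl L (IsCMField.complexConj L) 3 e₁ (Matrix.diagonal dV) (JW (↥(maximalRealSubfield L)) L ε) v)) :
                            localPi L (IsCMField.complexConj L) 3 (Matrix.diagonal dV) v →* _).comp
                          (localCongr L (IsCMField.complexConj L) g one_ne_zero
                            (F0P2cOmegaLocalType.formCongr_frame L H dV g hg) v).symm.toMulEquiv.toMonoidHom)) = ⊤)) ∧
      (∀ (v : HeightOneSpectrum (𝓞 ↥(maximalRealSubfield L))),
          (∀ w : PlacesOver L v, IsCMField.complexConj L • w.1 = w.1) →
          ∀ (T : GL (Fin 3) (UnitaryGroup.LocalRing L v)) (a : UnitaryGroup.LocalRing L v) (ha : IsUnit a)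
            (h : formCongr (conjLocal L (IsCMField.complexConj L) v) T (H.map (algebraMap L (UnitaryGroup.LocalRing L v))) =
              a • (Matrix.of fun i j : Fin 3 => if i.val + j.val + 1 = 3 then (1 : L) else 0).map (algebraMap L (UnitaryGroup.LocalRing L v))),
            ∃ x₀ : IrrClass (Gqs L v),
              x₀.IsConstituentOf (cmPrincipalSeries L 3 v (cmXiTorusChar L v (μω.semilocalComponent L v)
                (torusLocalComponent L (IsCMField.complexConj L) v ξ.η) (torusLocalComponent L (IsCMField.complexConj L) v ξ.ψ))) ∧
              ∃ ε : (↥(maximalRealSubfield L))ˣ,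
                (∀ (T' : Type) [AddCommGroup T'] [Module ℂ T'] (τ : Representation ℂ ↥(localPi L (IsCMField.complexConj L) 3 H v) T'), τ.IsIrreducible →
                  (IrrClass.comap (localPiEquiv L (IsCMField.complexConj L) 3 H v) (IrrClass.comap (cmDatumLocalCongr L v T ha h).symm x₀)).IsConstituentOf τ →
                  ∀ (W' : Type) [AddCommGroup W'] [Module ℂ W'] (ρ' : Representation ℂ ↥(localPi L (IsCMField.complexConj L) 3 H v) W'),
                    isotypicComponent (MonoidAlgebra ℂ (localPi L (IsCMField.complexConj L) 3 H v)) (Representation.asModule ρ')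
                        (Representation.asModule τ) = ⊤ →
                    isotypicComponent (MonoidAlgebra ℂ (localPi L (IsCMField.complexConj L) 3 H v)) (Representation.asModule ρ')
                      (Representation.asModule
                        (((show Representation ℂ (localPi L (IsCMField.complexConj L) 3 (Matrix.diagonal dV) v) _ from
                          (TwistedCoinv.rep (localCharOfCenter (↥(maximalRealSubfield L)) L (IsCMField.complexConj L)
                              (JW (↥(maximalRealSubfield L)) L ε) (JW_apply_ne_zero (↥(maximalRealSubfield L)) L ε) χf v)
                            ((OmegaChiSplitting.chiLocalSplittingsD ⟨L⟩ e₁ dV hdV hdV0 (toHeckeCharacter L μ')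
                              ((isOscillatorChar_toHeckeCharacter_iff μ').mpr hμ') ε).omegaLoc v)
                            (commute_omegaLoc_localCenter (↥(maximalRealSubfield L)) L (IsCMField.complexConj L) 3 e₁ (Matrix.diagonal dV)
                              (JW (↥(maximalRealSubfield L)) L ε) (complexConj_imagUnit L) (imagUnit_ne_zero L) (imagUnit_mul_self L)
                              (realDiagonal_isSymm L dV hdV) (isSymm_TW (↥(maximalRealSubfield L)) ε) (realDiagonal_map L dV hdV).symm
                              (JW_eq (↥(maximalRealSubfield L)) L ε) (JW_apply_ne_zero (↥(maximalRealSubfield L)) L ε)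
                              (OmegaChiSplitting.chiLocalSplittingsD ⟨L⟩ e₁ dV hdV hdV0 (toHeckeCharacter L μ')
                                ((isOscillatorChar_toHeckeCharacter_iff μ').mpr hμ') ε) v)).comp
                            (UnitaryGroup.localLineInl L (IsCMField.complexConj L) 3 e₁ (Matrix.diagonal dV) (JW (↥(maximalRealSubfield L)) L ε) v)) :
                            localPi L (IsCMField.complexConj L) 3 (Matrix.diagonal dV) v →* _).comp
                          (localCongr L (IsCMField.complexConj L) g one_ne_zero
                            (F0P2cOmegaLocalType.formCongr_frame L H dV g hg) v).symm.toMulEquiv.toMonoidHom)) = ⊤))) :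
    (∀ Pv : ∀ v : HeightOneSpectrum (𝓞 ↥(maximalRealSubfield L)), CMLocalAPacket L H v,
        ξ.IsXiLocalFamily hH hHd μω hμu Pv →
        ∀ (v : HeightOneSpectrum (𝓞 ↥(maximalRealSubfield L))),
          (∃ w : PlacesOver L v, IsCMField.complexConj L • w.1 ≠ w.1) →
          ∀ c : IrrClass ((cmDatum L 3 H).Local v), c ∈ (Pv v).members →
            ∃ ε : (↥(maximalRealSubfield L))ˣ,
              (∀ (T : Type) [AddCommGroup T] [Module ℂ T] (τ : Representation ℂ ↥(localPi L (IsCMField.complexConj L) 3 H v) T), τ.IsIrreducible →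
                (IrrClass.comap (localPiEquiv L (IsCMField.complexConj L) 3 H v) c).IsConstituentOf τ →
                ∀ (W' : Type) [AddCommGroup W'] [Module ℂ W'] (ρ' : Representation ℂ ↥(localPi L (IsCMField.complexConj L) 3 H v) W'),
                  isotypicComponent (MonoidAlgebra ℂ (localPi L (IsCMField.complexConj L) 3 H v)) (Representation.asModule ρ')
                      (Representation.asModule τ) = ⊤ →
                  isotypicComponent (MonoidAlgebra ℂ (localPi L (IsCMField.complexConj L) 3 H v)) (Representation.asModule ρ')
                    (Representation.asModule
                      (((show Representation ℂ (localPi L (IsCMField.complexConj L) 3 (Matrix.diagonal dV) v) _ from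
                        (TwistedCoinv.rep (localCharOfCenter (↥(maximalRealSubfield L)) L (IsCMField.complexConj L)
                            (JW (↥(maximalRealSubfield L)) L ε) (JW_apply_ne_zero (↥(maximalRealSubfield L)) L ε) χf v)
                          ((OmegaChiSplitting.chiLocalSplittingsD ⟨L⟩ e₁ dV hdV hdV0 (toHeckeCharacter L μ)
                            ((isOscillatorChar_toHeckeCharacter_iff μ).mpr hμ) ε).omegaLoc v)
                          (commute_omegaLoc_localCenter (↥(maximalRealSubfield L)) L (IsCMField.complexConj L) 3 e₁ (Matrix.diagonal dV)
                            (JW (↥(maximalRealSubfield L)) L ε) (complexConj_imagUnit L) (imagUnit_ne_zero L) (imagUnit_mul_self L)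
                            (realDiagonal_isSymm L dV hdV) (isSymm_TW (↥(maximalRealSubfield L)) ε) (realDiagonal_map L dV hdV).symm
                            (JW_eq (↥(maximalRealSubfield L)) L ε) (JW_apply_ne_zero (↥(maximalRealSubfield L)) L ε)
                            (OmegaChiSplitting.chiLocalSplittingsD ⟨L⟩ e₁ dV hdV hdV0 (toHeckeCharacter L μ)
                              ((isOscillatorChar_toHeckeCharacter_iff μ).mpr hμ) ε) v)).comp
                          (UnitaryGroup.localLineInl L (IsCMField.complexConj L) 3 e₁ (Matrix.diagonal dV) (JW (↥(maximalRealSubfield L)) L ε) v)) :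
                          localPi L (IsCMField.complexConj L) 3 (Matrix.diagonal dV) v →* _).comp
                        (localCongr L (IsCMField.complexConj L) g one_ne_zero
                          (F0P2cOmegaLocalType.formCongr_frame L H dV g hg) v).symm.toMulEquiv.toMonoidHom)) = ⊤)) ∧
    (∀ (v : HeightOneSpectrum (𝓞 ↥(maximalRealSubfield L))),
        (∀ w : PlacesOver L v, IsCMField.complexConj L • w.1 = w.1) →
        ∀ (T : GL (Fin 3) (UnitaryGroup.LocalRing L v)) (a : UnitaryGroup.LocalRing L v) (ha : IsUnit a)
          (h : formCongr (conjLocal L (IsCMField.complexConj L) v) T (H.map (algebraMap L (UnitaryGroup.LocalRing L v))) =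
            a • (Matrix.of fun i j : Fin 3 => if i.val + j.val + 1 = 3 then (1 : L) else 0).map (algebraMap L (UnitaryGroup.LocalRing L v))),
          ∃ x₀ : IrrClass (Gqs L v),
            x₀.IsConstituentOf (cmPrincipalSeries L 3 v (cmXiTorusChar L v (μω.semilocalComponent L v)
              (torusLocalComponent L (IsCMField.complexConj L) v ξ.η) (torusLocalComponent L (IsCMField.complexConj L) v ξ.ψ))) ∧
            ∃ ε : (↥(maximalRealSubfield L))ˣ,
              (∀ (T' : Type) [AddCommGroup T'] [Module ℂ T'] (τ : Representation ℂ ↥(localPi L (IsCMField.complexConj L) 3 H v) T'), τ.IsIrreducible →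
                (IrrClass.comap (localPiEquiv L (IsCMField.complexConj L) 3 H v) (IrrClass.comap (cmDatumLocalCongr L v T ha h).symm x₀)).IsConstituentOf τ →
                ∀ (W' : Type) [AddCommGroup W'] [Module ℂ W'] (ρ' : Representation ℂ ↥(localPi L (IsCMField.complexConj L) 3 H v) W'),
                  isotypicComponent (MonoidAlgebra ℂ (localPi L (IsCMField.complexConj L) 3 H v)) (Representation.asModule ρ')
                      (Representation.asModule τ) = ⊤ →
                  isotypicComponent (MonoidAlgebra ℂ (localPi L (IsCMField.complexConj L) 3 H v)) (Representation.asModule ρ')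
                    (Representation.asModule
                      (((show Representation ℂ (localPi L (IsCMField.complexConj L) 3 (Matrix.diagonal dV) v) _ from
                        (TwistedCoinv.rep (localCharOfCenter (↥(maximalRealSubfield L)) L (IsCMField.complexConj L)
                            (JW (↥(maximalRealSubfield L)) L ε) (JW_apply_ne_zero (↥(maximalRealSubfield L)) L ε) χf v)
                          ((OmegaChiSplitting.chiLocalSplittingsD ⟨L⟩ e₁ dV hdV hdV0 (toHeckeCharacter L μ)
                            ((isOscillatorChar_toHeckeCharacter_iff μ).mpr hμ) ε).omegaLoc v)
                          (commute_omegaLoc_localCenter (↥(maximalRealSubfield L)) L (IsCMField.complexConj L) 3 e₁ (Matrix.diagonal dV)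
                            (JW (↥(maximalRealSubfield L)) L ε) (complexConj_imagUnit L) (imagUnit_ne_zero L) (imagUnit_mul_self L)
                            (realDiagonal_isSymm L dV hdV) (isSymm_TW (↥(maximalRealSubfield L)) ε) (realDiagonal_map L dV hdV).symm
                            (JW_eq (↥(maximalRealSubfield L)) L ε) (JW_apply_ne_zero (↥(maximalRealSubfield L)) L ε)
                            (OmegaChiSplitting.chiLocalSplittingsD ⟨L⟩ e₁ dV hdV hdV0 (toHeckeCharacter L μ)
                              ((isOscillatorChar_toHeckeCharacter_iff μ).mpr hμ) ε) v)).comp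
                          (UnitaryGroup.localLineInl L (IsCMField.complexConj L) 3 e₁ (Matrix.diagonal dV) (JW (↥(maximalRealSubfield L)) L ε) v)) :
                          localPi L (IsCMField.complexConj L) 3 (Matrix.diagonal dV) v →* _).comp
                        (localCongr L (IsCMField.complexConj L) g one_ne_zero
                          (F0P2cOmegaLocalType.formCongr_frame L H dV g hg) v).symm.toMulEquiv.toMonoidHom)) = ⊤)) := by
  refine ⟨fun Pv hfam v hs c hc => ?_, fun v hns T a ha h => ?_⟩
  · obtain ⟨ε, hΘ⟩ := hm.1 Pv hfam v hs c hc
    exact ⟨ε, F0P2iGRDLocality.thetaTypeAt_congr_of_semilocal_eq L H e₁ dV hdV hdV0 g hg μ μ' hμ hμ' χf ε v c (hsl v) hΘ⟩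
  · obtain ⟨x₀, hx₀, ε, hΘ⟩ := hm.2 v hns T a ha h
    exact ⟨x₀, hx₀, ε, F0P2iGRDLocality.thetaTypeAt_congr_of_semilocal_eq L H e₁ dV hdV hdV0 g hg μ μ' hμ hμ' χf ε v
      (IrrClass.comap (cmDatumLocalCongr L v T ha h).symm x₀) (hsl v) hΘ⟩

/-! ## §6 `StubGRD` (v1.1 :318) from the matrix AT THE DICTIONARY PAIR ONLY -/

set_option synthInstance.maxHeartbeats 400000 in
set_option maxHeartbeats 8000000 in
/-- **`StubGRD` ⟸ the matrix at the dictionary pair.**  If for every CM frame, `ξ` and `μω` there is a pair `(μ₀, χf)` — `μ₀` conjugate-symplectic,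
`χf` continuous and unitary — satisfying the finite dictionary matrix AT `μ₀`, then `StubGRD` holds: its locality clause («every conjugate-symplectic `μ`
with the semi-local components of `μ₀`») is §5.  Hypothesis = the body of `F0P2PKPiRung4.StubGRD` (v1.1 :318) with the `∀ μ …` clause replaced by the matrix
at `(μ₀, hμ₀)`; conclusion = that body VERBATIM (`GRDMatrix`∕`ThetaTypeAt` inlined as in §5).  With the DICT-CHOICE PROTOCOL (P2 bus 08:32:01Z) the assembly
is `stubGRD_holds := stubGRD_of_pointwise (fun L … hquad => ⟨grdMu …, …, grdChi …, continuous_grdChi …, norm_grdChi …, ‹(S) at grdMu›, ‹(N) at grdMu›⟩)`.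
[cite: GelbartRogawski1991, §5.1 (5.1.1), Lem 5.1.2 p. 466] [cite: Rogawski1990, §13.3 p. 195; Lemma 4.13.1 (b) p. 62; §12.2 (2) p. 174] [cite: Kudla1994, §3 Thm. 3.1] -/
theorem stubGRD_of_pointwise
    (hpt :
      ∀ (L : Type) [Field L] [NumberField L] [IsCMField L] (H : Matrix (Fin 3) (Fin 3) L) (hH : (H.map (cmConjRingHom L))ᵀ = H) (hHd : IsUnit H.det)
        {n' : ℕ} (e₁ : Fin 3 × Fin 1 ≃ Fin n') (dV : Fin 3 → L) (hdV : ∀ i, IsCMField.complexConj L (dV i) = dV i) (hdV0 : ∀ i, dV i ≠ 0) (g : GL (Fin 3) L)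
        (hg : ((g : Matrix (Fin 3) (Fin 3) L).map (cmConjRingHom L))ᵀ * H * (g : Matrix (Fin 3) (Fin 3) L) = Matrix.diagonal dV)
        (ξ : OneDimAutRepH L) (μω : HeckeCharacter L) (hμu : μω.IsUnitary),
        (∀ x : Literature.NumberTheory.GaloisRepresentations.ideleGroup ↥(maximalRealSubfield L), μω (AdeleRing.ideleBaseChange (↥(maximalRealSubfield L)) L x) = quadraticHeckeCharCM L x) →
        ∃ (μ₀ : Literature.NumberTheory.Automorphic.IdeleClassGroup L →ₜ* Circle) (hμ₀ : IsConjugateSymplectic L μ₀)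
          (χf : UnitaryGroup.finAdelicOne (↥(maximalRealSubfield L)) L (IsCMField.complexConj L) →* ℂˣ),
          Continuous χf ∧ (∀ z, ‖((χf z : ℂˣ) : ℂ)‖ = 1) ∧
            ((∀ Pv : ∀ v : HeightOneSpectrum (𝓞 ↥(maximalRealSubfield L)), CMLocalAPacket L H v,
                ξ.IsXiLocalFamily hH hHd μω hμu Pv →
                ∀ (v : HeightOneSpectrum (𝓞 ↥(maximalRealSubfield L))),
                  (∃ w : PlacesOver L v, IsCMField.complexConj L • w.1 ≠ w.1) →
                  ∀ c : IrrClass ((cmDatum L 3 H).Local v), c ∈ (Pv v).members →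
                    ∃ ε : (↥(maximalRealSubfield L))ˣ,
                      (∀ (T : Type) [AddCommGroup T] [Module ℂ T] (τ : Representation ℂ ↥(localPi L (IsCMField.complexConj L) 3 H v) T), τ.IsIrreducible →
                        (IrrClass.comap (localPiEquiv L (IsCMField.complexConj L) 3 H v) c).IsConstituentOf τ →
                        ∀ (W' : Type) [AddCommGroup W'] [Module ℂ W'] (ρ' : Representation ℂ ↥(localPi L (IsCMField.complexConj L) 3 H v) W'),
                          isotypicComponent (MonoidAlgebra ℂ (localPi L (IsCMField.complexConj L) 3 H v)) (Representation.asModule ρ')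
                              (Representation.asModule τ) = ⊤ →
                          isotypicComponent (MonoidAlgebra ℂ (localPi L (IsCMField.complexConj L) 3 H v)) (Representation.asModule ρ')
                            (Representation.asModule
                              (((show Representation ℂ (localPi L (IsCMField.complexConj L) 3 (Matrix.diagonal dV) v) _ from
                                (TwistedCoinv.rep (localCharOfCenter (↥(maximalRealSubfield L)) L (IsCMField.complexConj L)
                                    (JW (↥(maximalRealSubfield L)) L ε) (JW_apply_ne_zero (↥(maximalRealSubfield L)) L ε) χf v)
                                  ((OmegaChiSplitting.chiLocalSplittingsD ⟨L⟩ e₁ dV hdV hdV0 (toHeckeCharacter L μ₀)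
                                    ((isOscillatorChar_toHeckeCharacter_iff μ₀).mpr hμ₀) ε).omegaLoc v)
                                  (commute_omegaLoc_localCenter (↥(maximalRealSubfield L)) L (IsCMField.complexConj L) 3 e₁ (Matrix.diagonal dV)
                                    (JW (↥(maximalRealSubfield L)) L ε) (complexConj_imagUnit L) (imagUnit_ne_zero L) (imagUnit_mul_self L)
                                    (realDiagonal_isSymm L dV hdV) (isSymm_TW (↥(maximalRealSubfield L)) ε) (realDiagonal_map L dV hdV).symm
                                    (JW_eq (↥(maximalRealSubfield L)) L ε) (JW_apply_ne_zero (↥(maximalRealSubfield L)) L ε)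
                                    (OmegaChiSplitting.chiLocalSplittingsD ⟨L⟩ e₁ dV hdV hdV0 (toHeckeCharacter L μ₀)
                                      ((isOscillatorChar_toHeckeCharacter_iff μ₀).mpr hμ₀) ε) v)).comp
                                  (UnitaryGroup.localLineInl L (IsCMField.complexConj L) 3 e₁ (Matrix.diagonal dV) (JW (↥(maximalRealSubfield L)) L ε) v)) :
                                  localPi L (IsCMField.complexConj L) 3 (Matrix.diagonal dV) v →* _).comp
                                (localCongr L (IsCMField.complexConj L) g one_ne_zero
                                  (F0P2cOmegaLocalType.formCongr_frame L H dV g hg) v).symm.toMulEquiv.toMonoidHom)) = ⊤)) ∧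
            (∀ (v : HeightOneSpectrum (𝓞 ↥(maximalRealSubfield L))),
                (∀ w : PlacesOver L v, IsCMField.complexConj L • w.1 = w.1) →
                ∀ (T : GL (Fin 3) (UnitaryGroup.LocalRing L v)) (a : UnitaryGroup.LocalRing L v) (ha : IsUnit a)
                  (h : formCongr (conjLocal L (IsCMField.complexConj L) v) T (H.map (algebraMap L (UnitaryGroup.LocalRing L v))) =
                    a • (Matrix.of fun i j : Fin 3 => if i.val + j.val + 1 = 3 then (1 : L) else 0).map (algebraMap L (UnitaryGroup.LocalRing L v))),
                  ∃ x₀ : IrrClass (Gqs L v),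
                    x₀.IsConstituentOf (cmPrincipalSeries L 3 v (cmXiTorusChar L v (μω.semilocalComponent L v)
                      (torusLocalComponent L (IsCMField.complexConj L) v ξ.η) (torusLocalComponent L (IsCMField.complexConj L) v ξ.ψ))) ∧
                    ∃ ε : (↥(maximalRealSubfield L))ˣ,
                      (∀ (T' : Type) [AddCommGroup T'] [Module ℂ T'] (τ : Representation ℂ ↥(localPi L (IsCMField.complexConj L) 3 H v) T'), τ.IsIrreducible →
                        (IrrClass.comap (localPiEquiv L (IsCMField.complexConj L) 3 H v) (IrrClass.comap (cmDatumLocalCongr L v T ha h).symm x₀)).IsConstituentOf τ →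
                        ∀ (W' : Type) [AddCommGroup W'] [Module ℂ W'] (ρ' : Representation ℂ ↥(localPi L (IsCMField.complexConj L) 3 H v) W'),
                          isotypicComponent (MonoidAlgebra ℂ (localPi L (IsCMField.complexConj L) 3 H v)) (Representation.asModule ρ')
                              (Representation.asModule τ) = ⊤ →
                          isotypicComponent (MonoidAlgebra ℂ (localPi L (IsCMField.complexConj L) 3 H v)) (Representation.asModule ρ')
                            (Representation.asModule
                              (((show Representation ℂ (localPi L (IsCMField.complexConj L) 3 (Matrix.diagonal dV) v) _ from
                                (TwistedCoinv.rep (localCharOfCenter (↥(maximalRealSubfield L)) L (IsCMField.complexConj L)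
                                    (JW (↥(maximalRealSubfield L)) L ε) (JW_apply_ne_zero (↥(maximalRealSubfield L)) L ε) χf v)
                                  ((OmegaChiSplitting.chiLocalSplittingsD ⟨L⟩ e₁ dV hdV hdV0 (toHeckeCharacter L μ₀)
                                    ((isOscillatorChar_toHeckeCharacter_iff μ₀).mpr hμ₀) ε).omegaLoc v)
                                  (commute_omegaLoc_localCenter (↥(maximalRealSubfield L)) L (IsCMField.complexConj L) 3 e₁ (Matrix.diagonal dV)
                                    (JW (↥(maximalRealSubfield L)) L ε) (complexConj_imagUnit L) (imagUnit_ne_zero L) (imagUnit_mul_self L)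
                                    (realDiagonal_isSymm L dV hdV) (isSymm_TW (↥(maximalRealSubfield L)) ε) (realDiagonal_map L dV hdV).symm
                                    (JW_eq (↥(maximalRealSubfield L)) L ε) (JW_apply_ne_zero (↥(maximalRealSubfield L)) L ε)
                                    (OmegaChiSplitting.chiLocalSplittingsD ⟨L⟩ e₁ dV hdV hdV0 (toHeckeCharacter L μ₀)
                                      ((isOscillatorChar_toHeckeCharacter_iff μ₀).mpr hμ₀) ε) v)).comp
                                  (UnitaryGroup.localLineInl L (IsCMField.complexConj L) 3 e₁ (Matrix.diagonal dV) (JW (↥(maximalRealSubfield L)) L ε) v)) :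
                                  localPi L (IsCMField.complexConj L) 3 (Matrix.diagonal dV) v →* _).comp
                                (localCongr L (IsCMField.complexConj L) g one_ne_zero
                                  (F0P2cOmegaLocalType.formCongr_frame L H dV g hg) v).symm.toMulEquiv.toMonoidHom)) = ⊤)))) :
    ∀ (L : Type) [Field L] [NumberField L] [IsCMField L] (H : Matrix (Fin 3) (Fin 3) L) (hH : (H.map (cmConjRingHom L))ᵀ = H) (hHd : IsUnit H.det)
      {n' : ℕ} (e₁ : Fin 3 × Fin 1 ≃ Fin n') (dV : Fin 3 → L) (hdV : ∀ i, IsCMField.complexConj L (dV i) = dV i) (hdV0 : ∀ i, dV i ≠ 0) (g : GL (Fin 3) L)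
      (hg : ((g : Matrix (Fin 3) (Fin 3) L).map (cmConjRingHom L))ᵀ * H * (g : Matrix (Fin 3) (Fin 3) L) = Matrix.diagonal dV)
      (ξ : OneDimAutRepH L) (μω : HeckeCharacter L) (hμu : μω.IsUnitary),
      (∀ x : Literature.NumberTheory.GaloisRepresentations.ideleGroup ↥(maximalRealSubfield L), μω (AdeleRing.ideleBaseChange (↥(maximalRealSubfield L)) L x) = quadraticHeckeCharCM L x) →
      ∃ (μ₀ : Literature.NumberTheory.Automorphic.IdeleClassGroup L →ₜ* Circle) (_hμ₀ : IsConjugateSymplectic L μ₀)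
        (χf : UnitaryGroup.finAdelicOne (↥(maximalRealSubfield L)) L (IsCMField.complexConj L) →* ℂˣ),
        Continuous χf ∧ (∀ z, ‖((χf z : ℂˣ) : ℂ)‖ = 1) ∧
        ∀ (μ : Literature.NumberTheory.Automorphic.IdeleClassGroup L →ₜ* Circle) (hμ : IsConjugateSymplectic L μ),
          (∀ v : HeightOneSpectrum (𝓞 ↥(maximalRealSubfield L)),
            (toHeckeCharacter L μ).semilocalComponent L v = (toHeckeCharacter L μ₀).semilocalComponent L v) →
          ((∀ Pv : ∀ v : HeightOneSpectrum (𝓞 ↥(maximalRealSubfield L)), CMLocalAPacket L H v,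
              ξ.IsXiLocalFamily hH hHd μω hμu Pv →
              ∀ (v : HeightOneSpectrum (𝓞 ↥(maximalRealSubfield L))),
                (∃ w : PlacesOver L v, IsCMField.complexConj L • w.1 ≠ w.1) →
                ∀ c : IrrClass ((cmDatum L 3 H).Local v), c ∈ (Pv v).members →
                  ∃ ε : (↥(maximalRealSubfield L))ˣ,
                    (∀ (T : Type) [AddCommGroup T] [Module ℂ T] (τ : Representation ℂ ↥(localPi L (IsCMField.complexConj L) 3 H v) T), τ.IsIrreducible →
                      (IrrClass.comap (localPiEquiv L (IsCMField.complexConj L) 3 H v) c).IsConstituentOf τ →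
                      ∀ (W' : Type) [AddCommGroup W'] [Module ℂ W'] (ρ' : Representation ℂ ↥(localPi L (IsCMField.complexConj L) 3 H v) W'),
                        isotypicComponent (MonoidAlgebra ℂ (localPi L (IsCMField.complexConj L) 3 H v)) (Representation.asModule ρ')
                            (Representation.asModule τ) = ⊤ →
                        isotypicComponent (MonoidAlgebra ℂ (localPi L (IsCMField.complexConj L) 3 H v)) (Representation.asModule ρ')
                          (Representation.asModule
                            (((show Representation ℂ (localPi L (IsCMField.complexConj L) 3 (Matrix.diagonal dV) v) _ from
                              (TwistedCoinv.rep (localCharOfCenter (↥(maximalRealSubfield L)) L (IsCMField.complexConj L)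
                                  (JW (↥(maximalRealSubfield L)) L ε) (JW_apply_ne_zero (↥(maximalRealSubfield L)) L ε) χf v)
                                ((OmegaChiSplitting.chiLocalSplittingsD ⟨L⟩ e₁ dV hdV hdV0 (toHeckeCharacter L μ)
                                  ((isOscillatorChar_toHeckeCharacter_iff μ).mpr hμ) ε).omegaLoc v)
                                (commute_omegaLoc_localCenter (↥(maximalRealSubfield L)) L (IsCMField.complexConj L) 3 e₁ (Matrix.diagonal dV)
                                  (JW (↥(maximalRealSubfield L)) L ε) (complexConj_imagUnit L) (imagUnit_ne_zero L) (imagUnit_mul_self L)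
                                  (realDiagonal_isSymm L dV hdV) (isSymm_TW (↥(maximalRealSubfield L)) ε) (realDiagonal_map L dV hdV).symm
                                  (JW_eq (↥(maximalRealSubfield L)) L ε) (JW_apply_ne_zero (↥(maximalRealSubfield L)) L ε)
                                  (OmegaChiSplitting.chiLocalSplittingsD ⟨L⟩ e₁ dV hdV hdV0 (toHeckeCharacter L μ)
                                    ((isOscillatorChar_toHeckeCharacter_iff μ).mpr hμ) ε) v)).comp
                                (UnitaryGroup.localLineInl L (IsCMField.complexConj L) 3 e₁ (Matrix.diagonal dV) (JW (↥(maximalRealSubfield L)) L ε) v)) :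
                                localPi L (IsCMField.complexConj L) 3 (Matrix.diagonal dV) v →* _).comp
                              (localCongr L (IsCMField.complexConj L) g one_ne_zero
                                (F0P2cOmegaLocalType.formCongr_frame L H dV g hg) v).symm.toMulEquiv.toMonoidHom)) = ⊤)) ∧
          (∀ (v : HeightOneSpectrum (𝓞 ↥(maximalRealSubfield L))),
              (∀ w : PlacesOver L v, IsCMField.complexConj L • w.1 = w.1) →
              ∀ (T : GL (Fin 3) (UnitaryGroup.LocalRing L v)) (a : UnitaryGroup.LocalRing L v) (ha : IsUnit a)
                (h : formCongr (conjLocal L (IsCMField.complexConj L) v) T (H.map (algebraMap L (UnitaryGroup.LocalRing L v))) =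
                  a • (Matrix.of fun i j : Fin 3 => if i.val + j.val + 1 = 3 then (1 : L) else 0).map (algebraMap L (UnitaryGroup.LocalRing L v))),
                ∃ x₀ : IrrClass (Gqs L v),
                  x₀.IsConstituentOf (cmPrincipalSeries L 3 v (cmXiTorusChar L v (μω.semilocalComponent L v)
                    (torusLocalComponent L (IsCMField.complexConj L) v ξ.η) (torusLocalComponent L (IsCMField.complexConj L) v ξ.ψ))) ∧
                  ∃ ε : (↥(maximalRealSubfield L))ˣ,
                    (∀ (T' : Type) [AddCommGroup T'] [Module ℂ T'] (τ : Representation ℂ ↥(localPi L (IsCMField.complexConj L) 3 H v) T'), τ.IsIrreducible →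
                      (IrrClass.comap (localPiEquiv L (IsCMField.complexConj L) 3 H v) (IrrClass.comap (cmDatumLocalCongr L v T ha h).symm x₀)).IsConstituentOf τ →
                      ∀ (W' : Type) [AddCommGroup W'] [Module ℂ W'] (ρ' : Representation ℂ ↥(localPi L (IsCMField.complexConj L) 3 H v) W'),
                        isotypicComponent (MonoidAlgebra ℂ (localPi L (IsCMField.complexConj L) 3 H v)) (Representation.asModule ρ')
                            (Representation.asModule τ) = ⊤ →
                        isotypicComponent (MonoidAlgebra ℂ (localPi L (IsCMField.complexConj L) 3 H v)) (Representation.asModule ρ')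
                          (Representation.asModule
                            (((show Representation ℂ (localPi L (IsCMField.complexConj L) 3 (Matrix.diagonal dV) v) _ from
                              (TwistedCoinv.rep (localCharOfCenter (↥(maximalRealSubfield L)) L (IsCMField.complexConj L)
                                  (JW (↥(maximalRealSubfield L)) L ε) (JW_apply_ne_zero (↥(maximalRealSubfield L)) L ε) χf v)
                                ((OmegaChiSplitting.chiLocalSplittingsD ⟨L⟩ e₁ dV hdV hdV0 (toHeckeCharacter L μ)
                                  ((isOscillatorChar_toHeckeCharacter_iff μ).mpr hμ) ε).omegaLoc v)
                                (commute_omegaLoc_localCenter (↥(maximalRealSubfield L)) L (IsCMField.complexConj L) 3 e₁ (Matrix.diagonal dV)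
                                  (JW (↥(maximalRealSubfield L)) L ε) (complexConj_imagUnit L) (imagUnit_ne_zero L) (imagUnit_mul_self L)
                                  (realDiagonal_isSymm L dV hdV) (isSymm_TW (↥(maximalRealSubfield L)) ε) (realDiagonal_map L dV hdV).symm
                                  (JW_eq (↥(maximalRealSubfield L)) L ε) (JW_apply_ne_zero (↥(maximalRealSubfield L)) L ε)
                                  (OmegaChiSplitting.chiLocalSplittingsD ⟨L⟩ e₁ dV hdV hdV0 (toHeckeCharacter L μ)
                                    ((isOscillatorChar_toHeckeCharacter_iff μ).mpr hμ) ε) v)).comp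
                                (UnitaryGroup.localLineInl L (IsCMField.complexConj L) 3 e₁ (Matrix.diagonal dV) (JW (↥(maximalRealSubfield L)) L ε) v)) :
                                localPi L (IsCMField.complexConj L) 3 (Matrix.diagonal dV) v →* _).comp
                              (localCongr L (IsCMField.complexConj L) g one_ne_zero
                                (F0P2cOmegaLocalType.formCongr_frame L H dV g hg) v).symm.toMulEquiv.toMonoidHom)) = ⊤))) := by
  intro L _ _ _ H hH hHd n' e₁ dV hdV hdV0 g hg ξ μω hμu hquad
  obtain ⟨μ₀, hμ₀, χf, hcont, hunit, hm⟩ := hpt L H hH hHd e₁ dV hdV hdV0 g hg ξ μω hμu hquad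
  exact ⟨μ₀, hμ₀, χf, hcont, hunit, fun μ hμ hsl =>
    grdMatrix_of_semilocal_eq L H hH hHd e₁ dV hdV hdV0 g hg ξ μω hμu μ μ₀ hμ hμ₀ χf hsl hm⟩


end Summit.HodgeConjecture.HodgeConjecture.Cruxes.H413.F0P2iGRDMatrixLocality

end
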